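import Summits.ABC.IUTFork.Cor312ThetaFiniteM
import HarnessLib

/-!
# [IUTchIII] Corollary 3.12, statement — "`−|log(Θ)|` is finite" for the M-LEVEL real setting over the genuine
# carriers `K_{v̲}`, `v̲ ∈ V̲`: the GOOD-PLACE hull `e⁻¹(Π_{v⃗} (R_{v⃗})^∼)` and `ThetaFinite` from three Θ-box conditions
# (G1-Θ unit P5a, second half, of `HOME/staging/w5/w5-d166/g4/G1-THETA-SHAPES.md`, C-lead ruling C-R12 (e) «target #2′»)

PROOF-ONLY record file (D-0012; no definitions, no `Prop` facts) of the abc-iut cell (R2 S-chain seat abc-iut-s2-p9,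
gen 0; branch C «abc ⇐ S»). TAKES NO SIDE on [IUTchIII] Cor. 3.12. Sequel of this seat's `Cor312ThetaFiniteM`
(§0–§2: `HullDefined` at every `(j, v_ℚ)` of every `Cor312.Setting.ofFrames` over abc-iut-w5-d166's M-level field-box
pieces `frameVolumePiecesOfInitialDH D hlog`, from BOUNDED and NONDEGENERATE Θ-boxes; the archimedean local Θ-volume is
`0`). THIS file — the M-level twin of §3–§4 of abc-iut-c312-7's `Cor312ThetaFinitePrVol` (p421738):

* §3 GOOD PLACES (`p_u > 2`, `p_u ∤ disc(K)`, `j ∈ 𝔽_l^⋇`, boxes `= 𝒪_L`): the hull of the union of ALL possible images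
  is `e⁻¹(Π_{v⃗} (R_{v⃗})^∼)` ([IUTchIV] Thm. 1.10 Step (vi) p. 29 "the “container of possible images” is precisely equal to
  the tensor product of log-shells"; every `K_{v̲}`, `v̲ | p_u`, is absolutely unramified off `disc(K)` —
  `absRamificationIdx_rescaledCompletion_eq_one_of_not_dvd_discr` at the number field `K`) and the local Θ-volume is
  `0`: `thetaHull_ofFramesM_eq_of_good`, `thetaLocal_ofFramesM_eq_zero`;
* §4 **`thetaFinite_ofFramesM`**: abc-iut-c312-7's `ThetaFinite` (`Cor312Statement`, FROZEN) from the same three Θ-box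
  conditions as at the F level (bounded, nondegenerate at every `(j ∈ 𝔽_l^⋇, u)`; equal to the unit polydisc off a
  finite set of finite places of `ℚ`), the finite exceptional set being `{u : p_u ∣ 2·|disc(K)|}` (finite:
  `finite_finitePlace_ratChar_dvd`, fibres of `u ↦ p_u` are abc-iut-c312-3's finite `placesOver ℚ p`).

[claim: Mochizuki2012, status: disputed] for the quoted sentences; [cite: DupuyHilado2025, §3.6, §4 (intro), §4.10];
[cite: Mochizuki2012, IUTchIV Thm 1.10 proof Step (vi) p. 29]; [cite: NeukirchANT1999, Ch. III Thm. (2.12)].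
HONEST FRAMING: bookkeeping at the genuine carriers; nothing here bears on the truth of [IUTchIII] Cor. 3.12
(`Cor312.Setting.Statement` untouched); typed ≠ proved; instantiated ≠ endorsed.
-/

noncomputable section

open Set Function NumberField IsDedekindDomain Bornology
open scoped Pointwise

namespace Summit.ABC.IUTFork.Thm311.Real

open Cor312 Cor312Vol Literature.IUT.LogThetaLattice Literature.IUT.LogVolume Literature.IUT.HodgeTheaters
  Literature.NumberTheory.NumberFields

variable {F K Fbar : Type} [Field F] [NumberField F] [Field K] [NumberField K] [Algebra F K]
  [Field Fbar] [Algebra F Fbar] [Algebra K Fbar] {E : WeierstrassCurve F} [E.IsElliptic] {l : ℕ}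
  {Pb : BadPlacePredicates K} (D : InitialThetaData F K Fbar E l Pb) {logvK : PadicLogsVal K}
  (hlog : LogvAnalyticVal logvK)

section Setting

variable (M : Type) [Field M] [NumberField M]
  (archPk : ∀ (j : (thetaIndexOfInitial D).Label) (vQ : (thetaIndexOfInitial D).VQ),
    Set ((logShellsOfInitialDH D logvK).Packet j vQ))
  (archSub : ∀ (j : (thetaIndexOfInitial D).Label) (v : (thetaIndexOfInitial D).V),
    Set ((logShellsOfInitialDH D logvK).Packet j ((thetaIndexOfInitial D).over v)))
  (Adm : ∀ (j : (thetaIndexOfInitial D).Label) (vQ : (thetaIndexOfInitial D).VQ),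
    Set ((logShellsOfInitialDH D logvK).Packet j vQ) → Prop)
  (logvol : ∀ (j : (thetaIndexOfInitial D).Label) (vQ : (thetaIndexOfInitial D).VQ),
    Set ((logShellsOfInitialDH D logvK).Packet j vQ) → ℝ)
  (Ψ : ℤ → ∀ v : (thetaIndexOfInitial D).V, v ∈ (thetaIndexOfInitial D).Vbad →
    Set ((logShellsOfInitialDH D logvK).StarPacket v))
  (act : ℤ → ∀ v : (thetaIndexOfInitial D).V, v ∈ (thetaIndexOfInitial D).Vbad →
    (logShellsOfInitialDH D logvK).StarPacket v → Module.End ℚ ((logShellsOfInitialDH D logvK).StarPacket v))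
  (Mmod : ℤ → ∀ j : (thetaIndexOfInitial D).LabelStar, Set ((logShellsOfInitialDH D logvK).GlobalPacket j.1))
  (region : ℤ → ∀ j : (thetaIndexOfInitial D).LabelStar, FinDivisor M → ∀ vQ : (thetaIndexOfInitial D).VQ,
    Set ((logShellsOfInitialDH D logvK).Packet j.1 vQ))
  (n : ℤ) {HT : Type} {LogLink : HT → HT → Type} {IsFull : ∀ {s t : HT}, LogLink s t → Prop}
  (lat : LGPGaussianLogThetaLattice LogLink IsFull)
  {Frd : Type} {IsoF : Frd → Frd → Type} {Ob : Frd → Type} {realify : Frd → Frd} {Strip : Type}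
  {IsoS : Strip → Strip → Type} {Mv : ∀ v : (thetaIndexOfInitial D).V, v ∈ (thetaIndexOfInitial D).Vbad → Type}
  [∀ v h, Monoid (Mv v h)]
  (sig : GlobalLGPFrobenioidSignature (thetaIndexOfInitial D).lstar (thetaIndexOfInitial D).V
    (· ∈ (thetaIndexOfInitial D).Vbad) Frd IsoF Ob realify Strip IsoS Mv)
  (split : SplittingMonoids Mv) {ObΔ : Type} {N : ∀ v : (thetaIndexOfInitial D).V, v ∈ (thetaIndexOfInitial D).Vbad → Type}
  [∀ v h, Monoid (N v h)] (qData : QPilotData ObΔ N)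
  (thetaBox : ℤ → Ob sig.Clgp → ∀ (j : (thetaIndexOfInitial D).Label) (vQ : (thetaIndexOfInitial D).VQ),
    Set (∀ s : factorIdxM D hlog j vQ, factorFieldM D hlog j vQ s))
  (qCentre : ObΔ → ∀ (j : (thetaIndexOfInitial D).Label) (vQ : (thetaIndexOfInitial D).VQ),
    ∀ s : factorIdxM D hlog j vQ, factorFieldM D hlog j vQ s)
  (hq : ∀ j vQ s, qCentre (qPilotObject qData) j vQ s ≠ 0)
  (hadm : ∀ (j : (thetaIndexOfInitial D).Label) (vQ : (thetaIndexOfInitial D).VQ)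
    (H : Set (∀ s : factorIdxM D hlog j vQ, factorFieldM D hlog j vQ s)), IsHullSet (factorFieldM D hlog j vQ) H →
      ((Situation.ofShells (logShellsOfInitialDH D logvK) M archPk archSub Adm logvol Ψ act Mmod region).D n).Adm j vQ
        (factorMapM D hlog j vQ ⁻¹' H))
  (hfin : ∀ j : (thetaIndexOfInitial D).Label, (Function.support fun vQ =>
    ((Situation.ofShells (logShellsOfInitialDH D logvK) M archPk archSub Adm logvol Ψ act Mmod region).D n).logvol j vQ
      (factorMapM D hlog j vQ ⁻¹' hullSet (factorFieldM D hlog j vQ) (qCentre (qPilotObject qData) j vQ))).Finite)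

/-! ## §3. Good places: the hull of the union of the possible images is `e⁻¹(Π_{v⃗} (R_{v⃗})^∼)`, of volume `0` -/

/-- The preimage under the M-level field-factor comparison of the unit polydisc `𝒪_L = hullSet 1` IS `e⁻¹(Π_{v⃗} (R_{v⃗})^∼)`
— at EVERY finite place (`ψ_{v⃗}((R_{v⃗})^∼) = Π_i 𝒪_{L_{v⃗,i}}`, campaign-S `image_normalizedPacket_eq_coe`; M-level twin of
abc-iut-c312-5's `preimage_factorMapDH_hullSet_one`). [cite: Mochizuki2012, IUTchIV Prop. 1.4 (i) p. 13] -/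
theorem preimage_factorMapM_hullSet_one (j : (thetaIndexOfInitial D).Label) (u : FinitePlace ℚ) :
    factorMapM D hlog j (Val.non u) ⁻¹' hullSet (factorFieldM D hlog j (Val.non u)) (fun _ => 1) =
      (presAtM D hlog u).comparison j ⁻¹' Set.pi univ fun e =>
        (normalizedPacket (ratChar u) ((presAtM D hlog u).kk e) : Set ((presAtM D hlog u).X e)) := by
  haveI : Nonempty ((thetaIndexOfInitial D).Caps j) := ⟨0⟩
  ext x
  simp only [Set.mem_preimage, Set.mem_univ_pi, SetLike.mem_coe]
  rw [hullSet, mem_polydisc]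
  constructor
  · intro h e
    have h1 : dEquiv (ratChar u) ((presAtM D hlog u).kk e) ((presAtM D hlog u).comparison j x e) ∈
        (piUnitBallStructure (DFac (ratChar u) ((presAtM D hlog u).kk e)) : Set _) := by
      rw [coe_piUnitBallStructure]
      refine (mem_polydisc _).2 fun i => ?_
      have h2 := h ⟨e, i⟩
      rw [norm_one] at h2
      exact h2
    rw [← image_normalizedPacket_eq_coe] at h1
    exact ((dEquiv (ratChar u) ((presAtM D hlog u).kk e)).injective.mem_set_image).1 h1
  · intro h s
    obtain ⟨e, i⟩ := s
    have h1 : dEquiv (ratChar u) ((presAtM D hlog u).kk e) ((presAtM D hlog u).comparison j x e) ∈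
        (piUnitBallStructure (DFac (ratChar u) ((presAtM D hlog u).kk e)) : Set _) := by
      rw [← image_normalizedPacket_eq_coe]
      exact ⟨_, h e, rfl⟩
    rw [coe_piUnitBallStructure] at h1
    have h2 := (mem_polydisc _).1 h1 i
    rw [norm_one]
    exact h2

/-- **At a GOOD place the hull of the union of ALL possible images IS `e⁻¹(Π_{v⃗} I_{v⃗})`** for the per-frame M-level setting:
for `p_u > 2`, `p_u ∤ disc(K)` and `j ∈ 𝔽_l^⋇`, if the union of the Θ-boxes at `(j, u)` is the unit polydisc `𝒪_L`, then
`^{n,∘}𝒰_{j,u} = e⁻¹(Π_{v⃗} I_{v⃗})` ([IUTchIV] Thm. 1.10 Step (vi): "the “container of possible images” is precisely equal to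
the tensor product of log-shells") — M-level twin of abc-iut-c312-7's `thetaHull_settingPrVol_eq_of_good`, same proof over
`presAtM` (the genuine `K_{v̲}` are absolutely unramified off `disc(K)`).
[cite: Mochizuki2012, IUTchIV Thm 1.10 proof Step (vi) p. 29] -/
theorem thetaHull_ofFramesM_eq_of_good (i : Fin (thetaIndexOfInitial D).lstar) (u : FinitePlace ℚ)
    (hp2 : 2 < ratChar u) (hdisc : ¬ ((ratChar u : ℕ) : ℤ) ∣ NumberField.discr K)
    (hbox : (⋃ m : ℤ, thetaBox m (thetaPilotObject sig split) (Setting.labelSucc i) (Val.non u)) =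
      hullSet (factorFieldM D hlog (Setting.labelSucc i) (Val.non u)) (fun _ => 1)) :
    (Setting.ofFrames n lat sig split qData
        ((frameVolumePiecesOfInitialDH D hlog).toRealFrames
          (S := Situation.ofShells (logShellsOfInitialDH D logvK) M archPk archSub Adm logvol Ψ act Mmod region)
          thetaBox qCentre) hq hadm hfin).thetaHull (Setting.labelSucc i) (Val.non u) =
      (presAtM D hlog u).latticePk (Setting.labelSucc i) 1 := by
  have hj := two_le_card_caps_labelSucc_M D i
  have he := absRamificationIdx_presAtM_eq_one D hlog u hdisc
  -- the lattice `Π I_v⃗` IS `𝒪_L` here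
  have hΛ : (presAtM D hlog u).latticeF (Setting.labelSucc i) 1 =
      hullSet (factorFieldM D hlog (Setting.labelSucc i) (Val.non u)) (fun _ => 1) :=
    (presAtM D hlog u).latticeF_one_eq_hullSet_of_unramified hp2 hj he
  have hHul : IsHullSet (factorFieldM D hlog (Setting.labelSucc i) (Val.non u))
      (hullSet (factorFieldM D hlog (Setting.labelSucc i) (Val.non u)) (fun _ => 1)) :=
    ⟨fun _ => 1, fun _ => one_ne_zero, rfl⟩
  -- the (Ind3)-region is `e⁻¹(𝒪_L) = latticePk 1`
  have h3 : (Setting.ofFrames n lat sig split qData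
        ((frameVolumePiecesOfInitialDH D hlog).toRealFrames
          (S := Situation.ofShells (logShellsOfInitialDH D logvK) M archPk archSub Adm logvol Ψ act Mmod region)
          thetaBox qCentre) hq hadm hfin).thetaRegion3 (Setting.labelSucc i) (Val.non u) =
      (presAtM D hlog u).latticePk (Setting.labelSucc i) 1 := by
    rw [thetaRegion3_ofFramesM, hbox]
    exact (preimage_factorMapM_hullSet_one D hlog _ u).trans
      ((presAtM D hlog u).latticePk_one_eq_of_unramified hp2 hj he).symm
  -- the union of the possible images has image `𝒪_L`
  have hU : factorMapM D hlog (Setting.labelSucc i) (Val.non u) ''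
      ⋃₀ (Setting.ofFrames n lat sig split qData
        ((frameVolumePiecesOfInitialDH D hlog).toRealFrames
          (S := Situation.ofShells (logShellsOfInitialDH D logvK) M archPk archSub Adm logvol Ψ act Mmod region)
          thetaBox qCentre) hq hadm hfin).possibleImages (Setting.labelSucc i) (Val.non u) =
      hullSet (factorFieldM D hlog (Setting.labelSucc i) (Val.non u)) (fun _ => 1) := by
    apply Set.Subset.antisymm
    · have hsub : ⋃₀ (Setting.ofFrames n lat sig split qData
          ((frameVolumePiecesOfInitialDH D hlog).toRealFrames
            (S := Situation.ofShells (logShellsOfInitialDH D logvK) M archPk archSub Adm logvol Ψ act Mmod region)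
            thetaBox qCentre) hq hadm hfin).possibleImages (Setting.labelSucc i) (Val.non u) ⊆
          (presAtM D hlog u).latticePk (Setting.labelSucc i) 1 :=
        (Setting.ofFrames n lat sig split qData
          ((frameVolumePiecesOfInitialDH D hlog).toRealFrames
            (S := Situation.ofShells (logShellsOfInitialDH D logvK) M archPk archSub Adm logvol Ψ act Mmod region)
            thetaBox qCentre) hq hadm hfin).sUnion_possibleImages_subset
          (fun Φ hΦ => (presAtM D hlog u).family_image_latticePk hΦ _ 1) h3.le
      rintro _ ⟨x, hx, rfl⟩
      rw [← hΛ]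
      exact ⟨(presAtM D hlog u).comparison _ x, hsub hx, rfl⟩
    · rw [← hbox, ← image_thetaRegion3_ofFramesM D hlog M archPk archSub Adm logvol Ψ act Mmod region n lat sig split qData
        thetaBox qCentre hq hadm hfin _ (Val.non u)]
      exact Set.image_mono
        ((Setting.ofFrames n lat sig split qData
          ((frameVolumePiecesOfInitialDH D hlog).toRealFrames
            (S := Situation.ofShells (logShellsOfInitialDH D logvK) M archPk archSub Adm logvol Ψ act Mmod region)
            thetaBox qCentre) hq hadm hfin).thetaRegion3_subset_sUnion _ _)
  have hb : Bornology.IsBounded (factorMapM D hlog (Setting.labelSucc i) (Val.non u) ''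
      ⋃₀ (Setting.ofFrames n lat sig split qData
        ((frameVolumePiecesOfInitialDH D hlog).toRealFrames
          (S := Situation.ofShells (logShellsOfInitialDH D logvK) M archPk archSub Adm logvol Ψ act Mmod region)
          thetaBox qCentre) hq hadm hfin).possibleImages (Setting.labelSucc i) (Val.non u)) := by
    rw [hU]
    exact isBounded_hullSet _ _
  -- compute the hull through the pulled-back real frame
  show ((HullFrame.ofLocalFields (factorFieldM D hlog (Setting.labelSucc i) (Val.non u))).comap
      (factorMapM D hlog (Setting.labelSucc i) (Val.non u))).hull
      (⋃₀ (Setting.ofFrames n lat sig split qData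
        ((frameVolumePiecesOfInitialDH D hlog).toRealFrames
          (S := Situation.ofShells (logShellsOfInitialDH D logvK) M archPk archSub Adm logvol Ψ act Mmod region)
          thetaBox qCentre) hq hadm hfin).possibleImages (Setting.labelSucc i) (Val.non u)) = _
  rw [HullFrame.comap_hull _ _ hb, hU,
    HullFrame.ofLocalFields_hull_eq _ (isBounded_hullSet _ _) hHul.isNondegenerate, holomorphicHull_hullSet]
  exact (preimage_factorMapM_hullSet_one D hlog _ u).trans
    ((presAtM D hlog u).latticePk_one_eq_of_unramified hp2 hj he).symm

/-- **At a GOOD place the local Θ-volume of the per-frame M-level setting is `0`** when the line `n` carries the field-box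
volumes (the hull is `e⁻¹(Π_{v⃗} (R_{v⃗})^∼) = e⁻¹(𝒪_L)`, of field-box log-volume `Σ_s W_s·μ̇^log(1) = 0`).
[cite: Mochizuki2012, IUTchIV Thm 1.10 proof Step (vi) p. 29] -/
theorem thetaLocal_ofFramesM_eq_zero
    (hV : (frameVolumePiecesOfInitialDH D hlog).Realizes
      ((Situation.ofShells (logShellsOfInitialDH D logvK) M archPk archSub Adm logvol Ψ act Mmod region).D n))
    (i : Fin (thetaIndexOfInitial D).lstar) (u : FinitePlace ℚ)
    (hp2 : 2 < ratChar u) (hdisc : ¬ ((ratChar u : ℕ) : ℤ) ∣ NumberField.discr K)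
    (hbox : (⋃ m : ℤ, thetaBox m (thetaPilotObject sig split) (Setting.labelSucc i) (Val.non u)) =
      hullSet (factorFieldM D hlog (Setting.labelSucc i) (Val.non u)) (fun _ => 1)) :
    (Setting.ofFrames n lat sig split qData
        ((frameVolumePiecesOfInitialDH D hlog).toRealFrames
          (S := Situation.ofShells (logShellsOfInitialDH D logvK) M archPk archSub Adm logvol Ψ act Mmod region)
          thetaBox qCentre) hq hadm hfin).thetaLocal (Setting.labelSucc i) (Val.non u) = ((0 : ℝ) : WithTop ℝ) := by
  have hHul : IsHullSet (factorFieldM D hlog (Setting.labelSucc i) (Val.non u))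
      (hullSet (factorFieldM D hlog (Setting.labelSucc i) (Val.non u)) (fun _ => 1)) :=
    ⟨fun _ => 1, fun _ => one_ne_zero, rfl⟩
  have hHD : (Setting.ofFrames n lat sig split qData
        ((frameVolumePiecesOfInitialDH D hlog).toRealFrames
          (S := Situation.ofShells (logShellsOfInitialDH D logvK) M archPk archSub Adm logvol Ψ act Mmod region)
          thetaBox qCentre) hq hadm hfin).HullDefined (Setting.labelSucc i) (Val.non u) :=
    hullDefined_ofFramesM_non D hlog M archPk archSub Adm logvol Ψ act Mmod region n lat sig split qData thetaBox qCentre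
      hq hadm hfin _ u (by rw [hbox]; exact isBounded_hullSet _ _) (by rw [hbox]; exact hHul.isNondegenerate)
  unfold Setting.thetaLocal
  rw [if_pos hHD, thetaHull_ofFramesM_eq_of_good D hlog M archPk archSub Adm logvol Ψ act Mmod region n lat sig split qData
      thetaBox qCentre hq hadm hfin i u hp2 hdisc hbox,
    (presAtM D hlog u).latticePk_one_eq_of_unramified hp2 (two_le_card_caps_labelSucc_M D i)
      (absRamificationIdx_presAtM_eq_one D hlog u hdisc),
    ← preimage_factorMapM_hullSet_one D hlog (Setting.labelSucc i) u]
  congr 1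
  rw [show (Setting.ofFrames n lat sig split qData
        ((frameVolumePiecesOfInitialDH D hlog).toRealFrames
          (S := Situation.ofShells (logShellsOfInitialDH D logvK) M archPk archSub Adm logvol Ψ act Mmod region)
          thetaBox qCentre) hq hadm hfin).n = n from rfl, hV.logvol_eq]
  exact (frameVolumePiecesOfInitialDH D hlog).logvol_preimage_hullSet_eq_zero_of_norm_eq_one (Setting.labelSucc i)
    (Val.non u) (fun _ => 1) fun _ => norm_one

/-! ## §4. `ThetaFinite` -/

/-- **`ThetaFinite` for the per-frame M-LEVEL real setting over the genuine carriers `K_{v̲}`, from three Θ-box conditions**: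
bounded and nondegenerate boxes at every `(j ∈ 𝔽_l^⋇, u)` (⇒ every local Θ-volume is a real number, §2), and boxes equal to
the unit polydisc off a finite set of finite places of `ℚ` (⇒ zero local Θ-volume at every further place whose prime does not
divide `2·disc(K)`, §3, so the global sum of [IUTchIII] Prop. 3.9 (iii) is a finite sum); the line `n` carries the field-box
volumes of unit P2′. The M-level twin of abc-iut-c312-7's `thetaFinite_settingPrVol`, with the SAME hypotheses read over
`Val ℚ`. [claim: Mochizuki2012, status: disputed] -/
theorem thetaFinite_ofFramesM
    (hV : (frameVolumePiecesOfInitialDH D hlog).Realizes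
      ((Situation.ofShells (logShellsOfInitialDH D logvK) M archPk archSub Adm logvol Ψ act Mmod region).D n))
    (hbdd : ∀ (i : Fin (thetaIndexOfInitial D).lstar) (u : FinitePlace ℚ),
      Bornology.IsBounded (⋃ m : ℤ, thetaBox m (thetaPilotObject sig split) (Setting.labelSucc i) (Val.non u)))
    (hnd : ∀ (i : Fin (thetaIndexOfInitial D).lstar) (u : FinitePlace ℚ),
      IsNondegenerate (factorFieldM D hlog (Setting.labelSucc i) (Val.non u))
        (⋃ m : ℤ, thetaBox m (thetaPilotObject sig split) (Setting.labelSucc i) (Val.non u)))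
    (hcof : ∀ i : Fin (thetaIndexOfInitial D).lstar, {u : FinitePlace ℚ |
      (⋃ m : ℤ, thetaBox m (thetaPilotObject sig split) (Setting.labelSucc i) (Val.non u)) ≠
        hullSet (factorFieldM D hlog (Setting.labelSucc i) (Val.non u)) (fun _ => 1)}.Finite) :
    (Setting.ofFrames n lat sig split qData
        ((frameVolumePiecesOfInitialDH D hlog).toRealFrames
          (S := Situation.ofShells (logShellsOfInitialDH D logvK) M archPk archSub Adm logvol Ψ act Mmod region)
          thetaBox qCentre) hq hadm hfin).ThetaFinite := by
  refine ⟨fun i vQ => thetaLocal_ne_top_ofFramesM D hlog M archPk archSub Adm logvol Ψ act Mmod region n lat sig split qData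
      thetaBox qCentre hq hadm hfin (Setting.labelSucc i) (hbdd i) (hnd i) vQ,
    fun i => ?_⟩
  have hD : 2 * (NumberField.discr K).natAbs ≠ 0 :=
    mul_ne_zero two_ne_zero (Int.natAbs_ne_zero.2 (NumberField.discr_ne_zero K))
  refine ((Set.finite_range Val.arc).union
    (((finite_finitePlace_ratChar_dvd hD).union (hcof i)).image Val.non)).subset ?_
  intro vQ hvQ
  rcases vQ with w | u
  · exact Or.inl ⟨w, rfl⟩
  · refine Or.inr ⟨u, ?_, rfl⟩
    by_contra hu
    simp only [Set.mem_union, Set.mem_setOf_eq, not_or, ne_eq, not_not] at hu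
    obtain ⟨hp2, hdisc⟩ := good_of_not_dvd_M (K := K) u hu.1
    have h0 : ((Setting.ofFrames n lat sig split qData
        ((frameVolumePiecesOfInitialDH D hlog).toRealFrames
          (S := Situation.ofShells (logShellsOfInitialDH D logvK) M archPk archSub Adm logvol Ψ act Mmod region)
          thetaBox qCentre) hq hadm hfin).thetaLocal (Setting.labelSucc i) (Val.non u)).untopD 0 = 0 := by
      rw [thetaLocal_ofFramesM_eq_zero D hlog M archPk archSub Adm logvol Ψ act Mmod region n lat sig split qData thetaBox
          qCentre hq hadm hfin hV i u hp2 hdisc hu.2,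
        WithTop.untopD_coe]
    exact absurd h0 hvQ

end Setting

end Summit.ABC.IUTFork.Thm311.Real

end
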